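import Literature.MathematicalPhysics.QuantumLattice.FermionQuasiFree
import Literature.MathematicalPhysics.QuantumLattice.FermionTraceFactorization
import HarnessLib

/-!
# Quasi-free Gibbs states of lattice fermions, II: the thermal Wick theorem (Gaudin's recursion)
and the determinant formula

Topic `MathematicalPhysics/QuantumLattice`; continuation of `FermionQuasiFree.lean` (second
quantisation `dGamma h`, pull-through formulas `creation_mul_gibbsWeight_dGamma`,
`annihilation_mul_gibbsWeight_dGamma`, the Fermi-matrix two-point function). Words in the
Jordan–Wigner generators are those of `FermionTraceFactorization.lean` (`JWLetter ι = ι × Bool`,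
`letterOp`, `wordOp`). Everything is PROVED; no named fact is introduced.

* `fermiWickSum φ pre w` — the alternating sum `Σ_k (-1)^k φ a_k (pre ++ w ∖ a_k)` along a word, by
  structural recursion, with its algebra (`fermiWickSum_add/_finset_sum/_smul/_const_mul/_congr`,
  `map_fermiWickSum`), the sign rule for a prefix on which `φ` vanishes
  (`fermiWickSum_append_of_forall_eq_zero`) and the closed form along `List.ofFn`
  (`fermiWickSum_ofFn`, deleting position `m` = composing with `m.succAbove`);
* `letterOp_mul_add_mul` — the CAR for letters, `l l' + l' l = {l, l'} · 1` with the scalar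
  anticommutator `letterAnticomm`; `letterOp_mul_wordOp` — the graded commutator of a letter
  with a word, `c (a₀⋯a_{m-1}) = Σ_k (-1)^k {c, a_k} a₀⋯â_k⋯a_{m-1} + (-1)^m (a₀⋯a_{m-1}) c`;
* `letterOp_mul_gibbsWeight_dGamma` — pull-through for letters with the matrix `pullMatrix β h b`
  (`(e^{βh})ᵀ` for creation, `e^{-βh}` for annihilation letters), `isUnit_one_add_pullMatrix`;
* `gaudin_linear_system` — for ANY one-body `h`: with `T(X) = tr(e^{-βdΓ(h)} X)`,
  `v_i = T((i,b) w)` solves `v_i - (-1)^{|w|} Σ_k P_{ik} v_k = Σ_k (-1)^k {(i,b), w_k} T(w ∖ w_k)`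
  (graded commutator + cyclicity of the trace + pull-through); `gaudin_solve` — the linear
  algebra extracting the recursion from the system when `1 + P` is invertible;
* `partitionFn_mul_trace_letterOp_mul_wordOp`, `gibbsState_dGamma_letterOp_mul_wordOp` —
  **Gaudin's recursion = the thermal Wick theorem**: for Hermitian `h`, real `β`, a letter `l`
  and a word `w` of odd length, `⟨l w⟩ = Σ_k (-1)^k ⟨l w_k⟩ ⟨w ∖ w_k⟩` in the Gibbs state of
  `dΓ(h)`; `trace_gibbsWeight_dGamma_letterOp_same` — `⟨c†c†⟩ = ⟨cc⟩ = 0`;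
* `gibbsState_dGamma_nestedWord` — **the determinant formula**
  `⟨c†_{i₀} ⋯ c†_{i_{n-1}} c_{j_{n-1}} ⋯ c_{j₀}⟩ = det [⟨c†_{i_k} c_{j_l}⟩]_{k,l}` (Gaudin's recursion
  along the first creation operator is the Laplace expansion along the first row).

This is the "well-known Wick rule" by which Benfatto–Giuliani–Mastropietro (Ann. Henri Poincaré
7 (2006) 809, §1.2) compute all Schwinger functions of the Hubbard model at `U = 0`, and the
algebraic content of the Grassmann (determinant) representation (2.6)–(2.8) of loc. cit. §2.1 on
which the renormalisation-group analysis behind the tree's fact `bgm_two_point_limit`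
(`HubbardFermiLiquid.lean`) is built. Combined with the imaginary-time evolution of the fields
(`exp_dGamma_mul_creation_mul_exp_neg` etc. of part I) it yields the time-ordered version by
multilinearity (not spelled out here).

## Mathlib / tree search

Mathlib: `List.ofFn`, `Fin.succAbove`, `Fin.rev_succAbove`, `Matrix.det_succ_row_zero` (Laplace
expansion), `Matrix.mulVec_injective_iff_isUnit`; no Wick/Pfaffian/quasi-free theorem
(`lean search 'Wick|pfaffian|quasiFree'`: nothing relevant). Tree: part I (`FermionQuasiFree`),
`FermionTraceFactorization` (`letterOp`, `wordOp`, `wordOp_cons/append`), the CAR discharges of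
`FermionOperatorsProofs`.

## References

* M. Gaudin, *Une démonstration simplifiée du théorème de Wick en mécanique statistique*,
  Nucl. Phys. 15 (1960) 89–91 (the trace-cyclicity proof formalised here). [Gaudin1960]
* O. Bratteli, D. W. Robinson, *Operator Algebras and Quantum Statistical Mechanics 2*, 2nd ed.
  (Springer 1997), §5.2.1 (CAR), §5.2.4 (the ideal Fermi gas; quasi-free states are determined
  by their two-point function). [BratteliRobinsonII1997]
* G. Benfatto, A. Giuliani, V. Mastropietro, Ann. Henri Poincaré 7 (2006) 809–898, §1.2 ("via the
  well-known Wick rule") and §2.1, eqs. (2.6)–(2.8). [BenfattoGiulianiMastropietro2006]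
-/

noncomputable section

namespace Literature.MathematicalPhysics.QuantumLattice

open NormedSpace Matrix Finset
open scoped ComplexOrder

/-! ### Alternating contraction sums along a word -/

section WickSum

variable {L M : Type*} [AddCommGroup M]

/-- The alternating ("Wick") sum of a two-argument function along a word with a fixed prefix:
`fermiWickSum φ pre [a₀, …, a_{m-1}] = Σ_k (-1)^k φ a_k (pre ++ [a₀, …, â_k, …, a_{m-1}])`,
defined by structural recursion (`φ a_0 (pre ++ w) - fermiWickSum φ (pre ++ [a₀]) w`). This is the shape of
both the graded commutator `[c, a₀ ⋯ a_{m-1}]_±` and of Wick's/Gaudin's recursion.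
Gaudin, Nucl. Phys. 15 (1960) 89. [folklore] -/
def fermiWickSum (φ : L → List L → M) : List L → List L → M
  | _, [] => 0
  | pre, a :: w => φ a (pre ++ w) - fermiWickSum φ (pre ++ [a]) w

/-- `fermiWickSum φ pre [] = 0`. [folklore] -/
@[simp] theorem fermiWickSum_nil (φ : L → List L → M) (pre : List L) :
    fermiWickSum φ pre [] = 0 := rfl

/-- The defining recursion of `fermiWickSum`. [folklore] -/
theorem fermiWickSum_cons (φ : L → List L → M) (pre : List L) (a : L) (w : List L) :
    fermiWickSum φ pre (a :: w) = φ a (pre ++ w) - fermiWickSum φ (pre ++ [a]) w := rfl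

/-- `fermiWickSum φ pre [a] = φ a pre`. [folklore] -/
theorem fermiWickSum_singleton (φ : L → List L → M) (pre : List L) (a : L) :
    fermiWickSum φ pre [a] = φ a pre := by
  rw [fermiWickSum_cons, List.append_nil, fermiWickSum_nil, sub_zero]

/-- `fermiWickSum` is additive in `φ`. [folklore] -/
theorem fermiWickSum_add (φ ψ : L → List L → M) (pre w : List L) :
    fermiWickSum (fun a u => φ a u + ψ a u) pre w =
      fermiWickSum φ pre w + fermiWickSum ψ pre w := by
  induction w generalizing pre with
  | nil => simp
  | cons a w ih => rw [fermiWickSum_cons, fermiWickSum_cons, fermiWickSum_cons, ih]; abel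

/-- `fermiWickSum` commutes with finite sums in `φ`. [folklore] -/
theorem fermiWickSum_finset_sum {κ : Type*} (s : Finset κ) (φ : κ → L → List L → M)
    (pre w : List L) :
    fermiWickSum (fun a u => ∑ k ∈ s, φ k a u) pre w = ∑ k ∈ s, fermiWickSum (φ k) pre w := by
  induction w generalizing pre with
  | nil => simp
  | cons a w ih => simp only [fermiWickSum_cons, ih, Finset.sum_sub_distrib]

/-- `fermiWickSum` is compatible with additive maps. [folklore] -/
theorem map_fermiWickSum {N : Type*} [AddCommGroup N] (g : M →+ N) (φ : L → List L → M)
    (pre w : List L) : g (fermiWickSum φ pre w) = fermiWickSum (fun a u => g (φ a u)) pre w := by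
  induction w generalizing pre with
  | nil => simp
  | cons a w ih => rw [fermiWickSum_cons, fermiWickSum_cons, map_sub, ih]

/-- `fermiWickSum` only depends on the values of `φ`. [folklore] -/
theorem fermiWickSum_congr {φ ψ : L → List L → M} (h : ∀ a u, φ a u = ψ a u) (pre w : List L) :
    fermiWickSum φ pre w = fermiWickSum ψ pre w := by
  induction w generalizing pre with
  | nil => simp
  | cons a w ih => rw [fermiWickSum_cons, fermiWickSum_cons, h, ih]

/-- Scalars independent of the position factor out of `fermiWickSum`. [folklore] -/
theorem fermiWickSum_smul {R : Type*} [Ring R] [Module R M] (c : R) (φ : L → List L → M)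
    (pre w : List L) : fermiWickSum (fun a u => c • φ a u) pre w = c • fermiWickSum φ pre w := by
  induction w generalizing pre with
  | nil => simp
  | cons a w ih => rw [fermiWickSum_cons, fermiWickSum_cons, ih, smul_sub]

/-- Constants factor out of `fermiWickSum` (ring-valued version). [folklore] -/
theorem fermiWickSum_const_mul {R : Type*} [Ring R] (c : R) (φ : L → List L → R) (pre w : List L) :
    fermiWickSum (fun a u => c * φ a u) pre w = c * fermiWickSum φ pre w :=
  fermiWickSum_smul c φ pre w

/-- A prefix on which `φ` vanishes only contributes its sign:
`fermiWickSum φ pre (X ++ w) = (-1)^{|X|} fermiWickSum φ (pre ++ X) w`. [folklore] -/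
theorem fermiWickSum_append_of_forall_eq_zero (φ : L → List L → M) {X : List L}
    (hX : ∀ a ∈ X, ∀ u, φ a u = 0) (pre w : List L) :
    fermiWickSum φ pre (X ++ w) = (-1 : ℤ) ^ X.length • fermiWickSum φ (pre ++ X) w := by
  induction X generalizing pre with
  | nil => simp
  | cons x X ih =>
    have hx : ∀ u, φ x u = 0 := hX x (by simp)
    have hX' : ∀ a ∈ X, ∀ u, φ a u = 0 := fun a ha => hX a (by simp [ha])
    rw [List.cons_append, fermiWickSum_cons, hx, zero_sub, ih hX' (pre ++ [x]), List.append_assoc,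
      List.singleton_append, List.length_cons, pow_succ, mul_neg, mul_one, neg_smul]

/-- Along a word given as `List.ofFn g`, `fermiWickSum` is the alternating sum over the deleted
position: `fermiWickSum φ pre (ofFn g) = Σ_m (-1)^m φ (g m) (pre ++ ofFn (g ∘ m.succAbove))`.
[folklore] -/
theorem fermiWickSum_ofFn (φ : L → List L → M) {n : ℕ} (g : Fin (n + 1) → L) (pre : List L) :
    fermiWickSum φ pre (List.ofFn g) =
      ∑ m : Fin (n + 1), (-1 : ℤ) ^ (m : ℕ) •
        φ (g m) (pre ++ List.ofFn fun i => g (m.succAbove i)) := by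
  induction n generalizing pre with
  | zero =>
    rw [List.ofFn_succ (f := g), List.ofFn_zero, fermiWickSum_singleton, Fin.sum_univ_one]
    simp
  | succ n ih =>
    have hcons : ∀ m : Fin (n + 1), (List.ofFn fun i => g (m.succ.succAbove i)) =
        g 0 :: List.ofFn fun i => g (m.succAbove i).succ := by
      intro m
      rw [List.ofFn_succ]
      simp only [Fin.succ_succAbove_zero, Fin.succ_succAbove_succ]
    rw [List.ofFn_succ (f := g), fermiWickSum_cons, ih]
    conv_rhs => rw [Fin.sum_univ_succ]
    simp only [Fin.val_zero, pow_zero, one_smul, Fin.zero_succAbove, hcons, Fin.val_succ,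
      pow_succ, mul_neg, mul_one, neg_smul, Finset.sum_neg_distrib, List.append_assoc,
      List.singleton_append, sub_eq_add_neg]

end WickSum

/-! ### Graded commutator of a letter with a word -/

section MoveThrough

variable {ι : Type*} [LinearOrder ι] [Fintype ι]

/-- The scalar anticommutator of two letters: `{c_i, c†_i} = {c†_i, c_i} = 1`, all other
anticommutators of generators vanish (CAR). Bratteli–Robinson II §5.2.1. [folklore] -/
def letterAnticomm (l l' : JWLetter ι) : ℂ := if l.1 = l'.1 ∧ l.2 ≠ l'.2 then 1 else 0

/-- **CAR for letters**: `letterOp l · letterOp l' + letterOp l' · letterOp l = {l, l'} · 1`.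
Bratteli–Robinson II §5.2.1, (5.2.11)–(5.2.12). [cite: BratteliRobinsonII1997, §5.2.1] -/
theorem letterOp_mul_add_mul (l l' : JWLetter ι) :
    letterOp l * letterOp l' + letterOp l' * letterOp l =
      letterAnticomm l l' • (1 : Matrix (Finset ι) (Finset ι) ℂ) := by
  obtain ⟨i, b⟩ := l
  obtain ⟨j, b'⟩ := l'
  cases b <;> cases b' <;>
    simp only [letterOp, letterAnticomm, if_true, Bool.false_eq_true, Bool.true_eq_false, if_false,
      ne_eq, not_true_eq_false, and_false, and_true, zero_smul, not_false_eq_true]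
  · exact annihilation_anticommute_holds i j
  · rw [annihilation_mul_creation_add_creation_mul_annihilation_holds i j]
    split_ifs <;> simp
  · rw [add_comm, annihilation_mul_creation_add_creation_mul_annihilation_holds j i]
    by_cases hij : i = j
    · subst hij; simp
    · simp [hij, Ne.symm hij]
  · exact creation_anticomm i j

/-- **Graded commutator of a letter with a word**:
`c · (a₀ ⋯ a_{m-1}) = Σ_k (-1)^k {c, a_k} a₀ ⋯ â_k ⋯ a_{m-1} + (-1)^m (a₀ ⋯ a_{m-1}) · c`
(move `c` through the word with the CAR). Gaudin, Nucl. Phys. 15 (1960) 89. [folklore] -/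
theorem letterOp_mul_wordOp (l : JWLetter ι) (pre w : List (JWLetter ι)) :
    wordOp pre * (letterOp l * wordOp w) =
      fermiWickSum (fun a u => letterAnticomm l a • wordOp u) pre w +
        (-1 : ℤ) ^ w.length • (wordOp pre * wordOp w * letterOp l) := by
  induction w generalizing pre with
  | nil => simp
  | cons a w ih =>
    have hla : letterOp l * letterOp a = letterAnticomm l a • 1 - letterOp a * letterOp l :=
      eq_sub_of_add_eq (letterOp_mul_add_mul l a)
    have ih' := ih (pre ++ [a])
    rw [wordOp_append, wordOp_cons, wordOp_nil, mul_one] at ih'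
    rw [wordOp_cons, ← mul_assoc (letterOp l), hla, sub_mul, Matrix.smul_mul, Matrix.one_mul,
      mul_sub, mul_assoc (letterOp a), ← mul_assoc (wordOp pre) (letterOp a), ih']
    simp only [fermiWickSum_cons, wordOp_append, List.length_cons, pow_succ, Matrix.mul_smul,
      mul_neg, mul_one, neg_smul, Matrix.mul_assoc]
    abel

end MoveThrough

/-! ### Gaudin's recursion (the thermal Wick theorem) for the Gibbs state of `dΓ(h)` -/

section Gaudin

variable {ι : Type*} [LinearOrder ι] [Fintype ι]

/-- The pull-through matrix of a letter type: `P⁽⁺⁾_{ik} = (e^{βh})_{ki}` for creation letters,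
`P⁽⁻⁾_{ik} = (e^{-βh})_{ik}` for annihilation letters. Gaudin, Nucl. Phys. 15 (1960) 89.
[folklore] -/
def pullMatrix (β : ℝ) (h : Matrix ι ι ℂ) (b : Bool) : Matrix ι ι ℂ :=
  if b then (exp ((β : ℂ) • h))ᵀ else exp (-((β : ℂ) • h))

/-- **Pull-through for letters**:
`letterOp (i,b) · e^{-βdΓ(h)} = Σ_k P⁽ᵇ⁾_{ik} e^{-βdΓ(h)} letterOp (k,b)`.
Gaudin, Nucl. Phys. 15 (1960) 89. [cite: Gaudin1960] -/
theorem letterOp_mul_gibbsWeight_dGamma (β : ℝ) (h : Matrix ι ι ℂ) (i : ι) (b : Bool) :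
    letterOp (i, b) * gibbsWeight β (dGamma h) =
      ∑ k, pullMatrix β h b i k • (gibbsWeight β (dGamma h) * letterOp (k, b)) := by
  cases b
  · simpa [letterOp, pullMatrix] using annihilation_mul_gibbsWeight_dGamma β h i
  · simpa [letterOp, pullMatrix] using creation_mul_gibbsWeight_dGamma β h i

/-- For Hermitian `h`, `1 + P⁽ᵇ⁾` is invertible (`1 + e^{±βh}` is positive definite). [folklore] -/
theorem isUnit_one_add_pullMatrix {h : Matrix ι ι ℂ} (hh : h.IsHermitian) (β : ℝ) (b : Bool) :
    IsUnit (1 + pullMatrix β h b) := by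
  cases b
  · have h1 := (posDef_one_add_exp_smul hh (-β)).isUnit
    simp only [Complex.ofReal_neg, neg_smul] at h1
    simpa [pullMatrix] using h1
  · have h1 := (posDef_one_add_exp_smul hh β).isUnit
    have h2 : (1 : Matrix ι ι ℂ) + pullMatrix β h true = (1 + exp ((β : ℂ) • h))ᵀ := by
      simp [pullMatrix, transpose_add]
    rw [h2, Matrix.isUnit_iff_isUnit_det, det_transpose, ← Matrix.isUnit_iff_isUnit_det]
    exact h1

/-- **Gaudin's linear system.** For any one-body `h`, letter type `b`, prefix-free word `w`, with
`W = e^{-βdΓ(h)}`, `T(X) = tr (W X)` and `v_i = T(letterOp (i,b) · w)`: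
`v_i - (-1)^{|w|} Σ_k P⁽ᵇ⁾_{ik} v_k = Σ_k (-1)^k {(i,b), w_k} T(w ∖ w_k)` (graded commutator,
cyclicity of the trace, pull-through). Gaudin, Nucl. Phys. 15 (1960) 89. [cite: Gaudin1960] -/
theorem gaudin_linear_system (β : ℝ) (h : Matrix ι ι ℂ) (b : Bool) (w : List (JWLetter ι)) (i : ι) :
    (gibbsWeight β (dGamma h) * (letterOp (i, b) * wordOp w)).trace -
        (-1 : ℤ) ^ w.length • ∑ k, pullMatrix β h b i k *
          (gibbsWeight β (dGamma h) * (letterOp (k, b) * wordOp w)).trace =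
      fermiWickSum
        (fun a u => letterAnticomm (i, b) a * (gibbsWeight β (dGamma h) * wordOp u).trace) [] w := by
  set W := gibbsWeight β (dGamma h) with hW
  -- the linear functional `X ↦ tr (W X)`
  set T : Matrix (Finset ι) (Finset ι) ℂ →+ ℂ :=
    (Matrix.traceAddMonoidHom (Finset ι) ℂ).comp (AddMonoidHom.mulLeft W) with hT
  have hTapp : ∀ X, T X = (W * X).trace := fun X => rfl
  -- graded commutator, then apply `T`
  have hmove := letterOp_mul_wordOp (i, b) [] w
  rw [wordOp_nil, one_mul, one_mul] at hmove
  have h1 : T (letterOp (i, b) * wordOp w) =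
      fermiWickSum (fun a u => letterAnticomm (i, b) a * (W * wordOp u).trace) [] w +
        (-1 : ℤ) ^ w.length • T (wordOp w * letterOp (i, b)) := by
    rw [hmove, map_add, map_zsmul, map_fermiWickSum]
    simp only [hTapp, Matrix.mul_smul, trace_smul, smul_eq_mul]
  -- cyclicity and pull-through
  have h2 : T (wordOp w * letterOp (i, b)) =
      ∑ k, pullMatrix β h b i k * (W * (letterOp (k, b) * wordOp w)).trace := by
    rw [hTapp, ← Matrix.mul_assoc, trace_mul_cycle, hW, letterOp_mul_gibbsWeight_dGamma,
      Finset.sum_mul, trace_sum]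
    simp only [Matrix.smul_mul, trace_smul, smul_eq_mul, Matrix.mul_assoc]
  rw [← hTapp, h1, h2, add_sub_cancel_right]

/-- `((1 + P) x)_i = x_i + Σ_k P_{ik} x_k`. [folklore] -/
theorem one_add_mulVec_apply (P : Matrix ι ι ℂ) (x : ι → ℂ) (i : ι) :
    ((1 + P) *ᵥ x) i = x i + ∑ k, P i k * x k := by
  rw [Matrix.add_mulVec, Matrix.one_mulVec]
  rfl

/-- **The linear algebra of Gaudin's argument.** If `1 + P` is invertible, the two-point data
`τ` solve `τ_i(a) + Σ_k P_{ik} τ_k(a) = Z {i, a}` and the unknowns `v` solve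
`v_i + Σ_k P_{ik} v_k = Σ_k (-1)^k {i, w_k} S(w ∖ w_k)`, then
`Z v_i = Σ_k (-1)^k τ_i(w_k) S(w ∖ w_k)` (both sides solve the same invertible linear system).
Gaudin, Nucl. Phys. 15 (1960) 89. [folklore] -/
theorem gaudin_solve {L' : Type*} {P : Matrix ι ι ℂ} (hP : IsUnit (1 + P)) (τ α : ι → L' → ℂ)
    (S : List L' → ℂ) (Z : ℂ) (v : ι → ℂ) (w : List L')
    (htwo : ∀ a i, τ i a + ∑ k, P i k * τ k a = Z * α i a)
    (hsys : ∀ i, v i + ∑ k, P i k * v k = fermiWickSum (fun a u => α i a * S u) [] w) (i : ι) :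
    Z * v i = fermiWickSum (fun a u => τ i a * S u) [] w := by
  set u : ι → ℂ := fun i => fermiWickSum (fun a u' => τ i a * S u') [] w with hu
  have hinj : Function.Injective (1 + P).mulVec := Matrix.mulVec_injective_iff_isUnit.2 hP
  have h1 : (1 + P) *ᵥ (Z • v) = (1 + P) *ᵥ u := by
    funext i'
    rw [one_add_mulVec_apply, one_add_mulVec_apply]
    have lhs : (Z • v) i' + ∑ k, P i' k * (Z • v) k =
        Z * fermiWickSum (fun a u => α i' a * S u) [] w := by
      simp only [Pi.smul_apply, smul_eq_mul]
      rw [← hsys i', mul_add, Finset.mul_sum]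
      congr 1
      exact Finset.sum_congr rfl fun k _ => by ring
    have rhs : u i' + ∑ k, P i' k * u k = Z * fermiWickSum (fun a u => α i' a * S u) [] w := by
      have e : ∑ k, P i' k * u k =
          fermiWickSum (fun a u' => ∑ k, P i' k * (τ k a * S u')) [] w := by
        rw [fermiWickSum_finset_sum]
        exact Finset.sum_congr rfl fun k _ => (fermiWickSum_const_mul _ _ [] w).symm
      rw [e, hu, ← fermiWickSum_add, ← fermiWickSum_const_mul Z]
      refine fermiWickSum_congr (fun a u' => ?_) [] w
      rw [← mul_assoc Z, ← htwo a i', add_mul, Finset.sum_mul]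
      simp only [mul_assoc]
    rw [lhs, rhs]
  have h2 := congrFun (hinj h1) i
  simpa [hu] using h2

/-- **Gaudin's recursion — the thermal Wick theorem for a quasi-free Gibbs state
(un-normalised form).** For Hermitian `h`, real `β`, a letter `l` and a word `w` of odd length,
with `T(X) = tr(e^{-βdΓ(h)} X)` and `Z = T(1)`:
`Z · T(l w) = Σ_k (-1)^k T(l w_k) T(w ∖ w_k)`.
Gaudin, Nucl. Phys. 15 (1960) 89 (the formula for `⟨α₁ ⋯ α_{2n}⟩`); Bratteli–Robinson II
§5.2.4. [cite: Gaudin1960] -/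
theorem partitionFn_mul_trace_letterOp_mul_wordOp {h : Matrix ι ι ℂ} (hh : h.IsHermitian)
    (β : ℝ) (l : JWLetter ι) {w : List (JWLetter ι)} (hw : Odd w.length) :
    partitionFn β (dGamma h) * (gibbsWeight β (dGamma h) * (letterOp l * wordOp w)).trace =
      fermiWickSum (fun a u => (gibbsWeight β (dGamma h) * (letterOp l * letterOp a)).trace *
        (gibbsWeight β (dGamma h) * wordOp u).trace) [] w := by
  obtain ⟨i, b⟩ := l
  refine gaudin_solve (isUnit_one_add_pullMatrix hh β b)
    (fun i a => (gibbsWeight β (dGamma h) * (letterOp (i, b) * letterOp a)).trace)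
    (fun i a => letterAnticomm (i, b) a) (fun u => (gibbsWeight β (dGamma h) * wordOp u).trace)
    (partitionFn β (dGamma h))
    (fun i => (gibbsWeight β (dGamma h) * (letterOp (i, b) * wordOp w)).trace) w
    (fun a i' => ?_) (fun i' => ?_) i
  · -- the two-point system: `gaudin_linear_system` for the one-letter word `[a]`
    have := gaudin_linear_system β h b [a] i'
    rw [List.length_singleton, pow_one, neg_smul, one_smul, sub_neg_eq_add, fermiWickSum_singleton,
      wordOp_cons, wordOp_nil, mul_one, Matrix.mul_one] at this
    rw [this, mul_comm]
    rfl
  · have := gaudin_linear_system β h b w i'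
    rwa [hw.neg_one_pow, neg_smul, one_smul, sub_neg_eq_add] at this

/-- `tr (e^{-βdΓ(h)} c†_i c†_j) = tr (e^{-βdΓ(h)} c_i c_j) = 0`: anomalous two-point traces vanish
(their linear system has zero right-hand side). Bratteli–Robinson II §5.2.4 (gauge invariance
of the Gibbs state). [folklore] -/
theorem trace_gibbsWeight_dGamma_letterOp_same {h : Matrix ι ι ℂ} (hh : h.IsHermitian) (β : ℝ)
    (b : Bool) (i j : ι) :
    (gibbsWeight β (dGamma h) * (letterOp (i, b) * letterOp (j, b))).trace = 0 := by
  set t : ι → ℂ := fun i' =>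
    (gibbsWeight β (dGamma h) * (letterOp (i', b) * letterOp (j, b))).trace with ht
  have hsys : (1 + pullMatrix β h b) *ᵥ t = 0 := by
    funext i'
    have := gaudin_linear_system β h b [(j, b)] i'
    rw [List.length_singleton, pow_one, neg_smul, one_smul, sub_neg_eq_add, fermiWickSum_singleton,
      wordOp_cons, wordOp_nil, mul_one] at this
    have h0 : letterAnticomm (i', b) (j, b) = 0 := by simp [letterAnticomm]
    rw [h0, zero_mul] at this
    rw [one_add_mulVec_apply]
    exact this
  have hinj : Function.Injective (1 + pullMatrix β h b).mulVec :=
    Matrix.mulVec_injective_iff_isUnit.2 (isUnit_one_add_pullMatrix hh β b)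
  have ht0 : t = 0 := hinj (by rw [hsys, Matrix.mulVec_zero])
  exact congrFun ht0 i

/-- **The thermal Wick theorem (Gaudin's recursion), normalised form.** For Hermitian `h`, real
`β`, a letter `l` and a word `w = a₀ ⋯ a_{m-1}` of odd length `m`, in the Gibbs state
`⟨·⟩ = tr(e^{-βdΓ(h)} ·)/Z` of the quadratic Hamiltonian `dΓ(h)`:
`⟨l a₀ ⋯ a_{m-1}⟩ = Σ_k (-1)^k ⟨l a_k⟩ ⟨a₀ ⋯ â_k ⋯ a_{m-1}⟩`.
Iterating expresses every even moment as the Pfaffian of the two-point functions ("Wick rule",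
BGM 2006 §1.2). Gaudin, Nucl. Phys. 15 (1960) 89; Bratteli–Robinson II §5.2.4.
[cite: Gaudin1960] -/
theorem gibbsState_dGamma_letterOp_mul_wordOp {h : Matrix ι ι ℂ} (hh : h.IsHermitian) (β : ℝ)
    (l : JWLetter ι) {w : List (JWLetter ι)} (hw : Odd w.length) :
    gibbsState β (dGamma h) (letterOp l * wordOp w) =
      fermiWickSum (fun a u => gibbsState β (dGamma h) (letterOp l * letterOp a) *
        gibbsState β (dGamma h) (wordOp u)) [] w := by
  haveI : Nonempty (Finset ι) := ⟨∅⟩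
  have hZ : partitionFn β (dGamma h) ≠ 0 := (partitionFn_pos β (isHermitian_dGamma hh)).ne'
  have key := partitionFn_mul_trace_letterOp_mul_wordOp hh β l hw
  have hφ : ∀ (a : JWLetter ι) (u : List (JWLetter ι)),
      gibbsState β (dGamma h) (letterOp l * letterOp a) * gibbsState β (dGamma h) (wordOp u) =
        ((partitionFn β (dGamma h))⁻¹ * (partitionFn β (dGamma h))⁻¹) *
          ((gibbsWeight β (dGamma h) * (letterOp l * letterOp a)).trace *
            (gibbsWeight β (dGamma h) * wordOp u).trace) := by
    intro a u
    simp only [gibbsState_apply]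
    ring
  rw [fermiWickSum_congr hφ [] w, fermiWickSum_const_mul, ← key, gibbsState_apply, mul_assoc,
    inv_mul_cancel_left₀ hZ]

end Gaudin

/-! ### The determinant formula for `⟨c†_{i₀} ⋯ c†_{i_{n-1}} c_{j_{n-1}} ⋯ c_{j₀}⟩` -/

section Determinant

variable {ι : Type*} [LinearOrder ι] [Fintype ι]

/-- The nested normal-ordered word `c†_{i₀} ⋯ c†_{i_{n-1}} c_{j_{n-1}} ⋯ c_{j₀}`. [folklore] -/
def nestedWord (n : ℕ) (i j : Fin n → ι) : List (JWLetter ι) :=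
  List.ofFn (fun k => (i k, true)) ++ List.ofFn (fun k => (j (Fin.rev k), false))

/-- Sign bookkeeping for the Laplace expansion: `(-1)^n (-1)^m = (-1)^{rev m}` on `Fin (n+1)`.
[folklore] -/
theorem neg_one_pow_mul_neg_one_pow_eq_pow_rev (n : ℕ) (m : Fin (n + 1)) :
    (-1 : ℂ) ^ n * (-1) ^ (m : ℕ) = (-1) ^ (Fin.rev m : ℕ) := by
  obtain ⟨m, hm⟩ := m
  simp only [Fin.val_rev]
  obtain ⟨d, rfl⟩ := Nat.exists_eq_add_of_le (Nat.lt_succ_iff.mp hm)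
  have hd : m + d + 1 - (m + 1) = d := by omega
  rw [hd, pow_add, mul_comm ((-1 : ℂ) ^ m) ((-1) ^ d), mul_assoc, ← mul_pow, neg_one_mul,
    neg_neg, one_pow, mul_one]

/-- **Thermal Wick theorem, determinant form.** For Hermitian `h` and real `β`, in the Gibbs
state of `dΓ(h)`,
`⟨c†_{i₀} ⋯ c†_{i_{n-1}} c_{j_{n-1}} ⋯ c_{j₀}⟩ = det [⟨c†_{i_k} c_{j_l}⟩]_{k,l}`
(Gaudin's recursion along the first creation operator is the Laplace expansion along the first
row; the `c†c†` contractions vanish). This is the "Wick rule" by which BGM compute all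
Schwinger functions at `U = 0` (BGM 2006 §1.2) and the origin of the Grassmann/determinant
representation (2.6)–(2.8) of loc. cit. §2.1. Gaudin, Nucl. Phys. 15 (1960) 89;
Bratteli–Robinson II §5.2.4. [cite: Gaudin1960] -/
theorem gibbsState_dGamma_nestedWord {h : Matrix ι ι ℂ} (hh : h.IsHermitian) (β : ℝ) (n : ℕ)
    (i j : Fin n → ι) :
    gibbsState β (dGamma h) (wordOp (nestedWord n i j)) =
      (Matrix.of fun k l => gibbsState β (dGamma h) (creation (i k) * annihilation (j l))).det := by
  haveI : Nonempty (Finset ι) := ⟨∅⟩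
  have hZ : partitionFn β (dGamma h) ≠ 0 := (partitionFn_pos β (isHermitian_dGamma hh)).ne'
  induction n with
  | zero => simp [nestedWord, gibbsState_one β _ hZ]
  | succ n ih =>
    set M : Matrix (Fin (n + 1)) (Fin (n + 1)) ℂ :=
      Matrix.of fun k l => gibbsState β (dGamma h) (creation (i k) * annihilation (j l)) with hM
    have hM0 : ∀ c, M 0 c = gibbsState β (dGamma h) (creation (i 0) * annihilation (j c)) :=
      fun c => rfl
    -- the word: first creation operator, then the odd-length remainder `X ++ A`
    have hw : nestedWord (n + 1) i j = (i 0, true) ::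
        (List.ofFn (fun k : Fin n => (i k.succ, true)) ++
          List.ofFn (fun k : Fin (n + 1) => (j (Fin.rev k), false))) := by
      simp only [nestedWord]
      rw [List.ofFn_succ (f := fun k : Fin (n + 1) => (i k, true)), List.cons_append]
    have hodd : Odd (List.ofFn (fun k : Fin n => (i k.succ, true)) ++
        List.ofFn (fun k : Fin (n + 1) => (j (Fin.rev k), false))).length := by
      rw [List.length_append, List.length_ofFn, List.length_ofFn]
      exact ⟨n, by omega⟩
    -- the `c†c†` contractions vanish
    have hX : ∀ a ∈ List.ofFn (fun k : Fin n => (i k.succ, true)), ∀ u : List (JWLetter ι),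
        gibbsState β (dGamma h) (letterOp (i 0, true) * letterOp a) *
          gibbsState β (dGamma h) (wordOp u) = 0 := by
      intro a ha u
      obtain ⟨k, rfl⟩ := List.mem_ofFn.1 ha
      simp [gibbsState_apply, trace_gibbsWeight_dGamma_letterOp_same hh]
    -- the remaining words are nested words of size `n` (induction hypothesis)
    have ih' : ∀ m : Fin (n + 1), gibbsState β (dGamma h) (wordOp
        (List.ofFn (fun k : Fin n => (i k.succ, true)) ++
          List.ofFn (fun k : Fin n => (j ((Fin.rev m).succAbove (Fin.rev k)), false)))) =
        (M.submatrix Fin.succ (Fin.rev m).succAbove).det := fun m =>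
      ih (fun k => i k.succ) (fun l => j ((Fin.rev m).succAbove l))
    rw [hw, wordOp_cons, gibbsState_dGamma_letterOp_mul_wordOp hh β _ hodd,
      fermiWickSum_append_of_forall_eq_zero _ hX, List.length_ofFn, List.nil_append,
      fermiWickSum_ofFn, Finset.smul_sum]
    conv_rhs => rw [Matrix.det_succ_row_zero, ← Equiv.sum_comp Fin.revPerm]
    refine Finset.sum_congr rfl fun m _ => ?_
    simp only [Fin.rev_succAbove, ih', Fin.revPerm_apply, hM0, zsmul_eq_mul, Int.cast_pow,
      Int.cast_neg, Int.cast_one, letterOp, if_true, Bool.false_eq_true, if_false]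
    rw [← mul_assoc, ← mul_assoc, neg_one_pow_mul_neg_one_pow_eq_pow_rev]

end Determinant


end Literature.MathematicalPhysics.QuantumLattice
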